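import Literature.NumberTheory.EllipticCurves.KatoTwistedSelmerFiniteness
import Literature.NumberTheory.EllipticCurves.KatoTwistedFinitenessKummerDescentProofs
import HarnessLib

/-!
# Kato 2004, Cor. 14.3: part (2) (Mordell–Weil `χ`-parts) from part (1) (Selmer `χ`-parts),
# at the level of the tree's two named facts

K. Kato, *`p`-adic Hodge theory and values of zeta functions of modular forms*, Astérisque 295
(2004), Cor. 14.3 (p. 235), of Thm. 14.2 (2): for `A/ℚ` a quotient of `J₁(N)`, `K/ℚ` finite
abelian and a character `χ` of `Gal(K/ℚ)` with `L(A, χ, 1) ≠ 0`, "(1) The `χ`-part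
`Sel(K, A ⊗_ℚ K)^(χ)` of `Sel(K, A ⊗_ℚ K)` is finite. (2) The `χ`-part of `A(K)^(χ)` is finite."
In the printed proof (2) is read off (1): `A(K) ⊗ ℚ_p/ℤ_p ↪ Sel(K, A ⊗_ℚ K)[p^∞]` (Kummer), and a
finitely generated `G`-module whose `χ`-part has finite image there has finite `χ`-part.

In the tree, for `A = E` an elliptic curve over `ℚ` and `K = ℚ(ζ_m)`:

* part (1) is the named fact `kato_finite_chiPart_selmer_of_twistedLValue_ne_zero`
  (`KatoTwistedSelmerFiniteness.lean`; every prime `p`, `m ≢ 2 (mod 4)`);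
* part (2) is the named fact `kato_finite_chiPart_of_twistedLValue_ne_zero`
  (`KatoTwistedFiniteness.lean`; `m ≢ 2 (mod 4)`), with its all-moduli companion
  `kato_finite_chiPart_cyclotomic_of_twistedLValue_ne_zero` (same file);
* the passage (1) ⇒ (2) is PROVED (`χ`-part Kummer descent at one prime `p`,
  `kato_finite_chiPart_of_twistedLValue_ne_zero_of_selmer`,
  `KatoTwistedFinitenessKummerDescentProofs.lean`), with hypothesis `hSel` = part (1) at SOME
  prime `p`.

This file records the two resulting implications between the NAMED FACTS, so that every tree
consumer of part (2) (hypotheses `hK : kato_finite_chiPart_of_twistedLValue_ne_zero` in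
`KatoTwistedFiniteness{Descent,ChiQuotient,AbelianField,EulerFactors,Isotypic,TowerRank,
TrivialCharacter}Proofs`, `KatoChiPartIsotypicDecomposition`, …) is fed by part (1) alone:

* `kato_finite_chiPart_of_twistedLValue_ne_zero_of_kato_finite_chiPart_selmer` —
  (1) ⇒ (2) for `m ≢ 2 (mod 4)` (the descent run at `p = 2`; any prime would do);
* `kato_finite_chiPart_cyclotomic_of_twistedLValue_ne_zero_of_kato_finite_chiPart_selmer` —
  (1) ⇒ (2) for every `m ≥ 1` (through `kato_finite_chiPart_cyclotomic_of_twistedLValue_ne_zero_of`,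
  `KatoTwistedFinitenessProofs.lean`: `m ≡ 2 (mod 4)` reduces to `m/2`).

Theorems only; no new definitions or facts. Deliberately NOT here: any part of Kato's proof of
Thm. 14.2 (Euler system of Beilinson elements, §§8–13, 14.6–14.13).

## References

* K. Kato, *`p`-adic Hodge theory and values of zeta functions of modular forms*, Astérisque 295
  (2004), 117–290: Thm. 14.2 (2), Cor. 14.3 (1)(2) (p. 235). [Kato2004Asterisque]
-/

noncomputable section

-- `Classical` is scoped-open exactly as in `KatoTwistedSelmerFiniteness` and
-- `KatoTwistedFinitenessKummerDescentProofs` (the decidability instance on `ℚ(ζ_m)`).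
open scoped Classical

open WeierstrassCurve CongruenceSubgroup

namespace Literature.NumberTheory.EllipticCurves

open GaloisRepresentations ModularForms

set_option backward.isDefEq.respectTransparency false in
/-- **Kato 2004, Cor. 14.3: (1) ⇒ (2) over `ℚ(ζ_m)`, `m ≢ 2 (mod 4)`, between the tree's named
facts.** If for every elliptic curve `E/ℚ` with newform `f`, every `m ≢ 2 (mod 4)`, every
Dirichlet character `χ` mod `m` with `L(f, χ, 1) ≠ 0` and every prime `p` the `χ`-part of
`Sel_{p^∞}(E/ℚ(ζ_m))` is finite (`kato_finite_chiPart_selmer_of_twistedLValue_ne_zero`, Cor. 14.3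
(1)), then under the same hypotheses the `χ`-part of `E(ℚ(ζ_m))` is finite
(`kato_finite_chiPart_of_twistedLValue_ne_zero`, Cor. 14.3 (2)). Proof: the proved `χ`-part
Kummer descent `kato_finite_chiPart_of_twistedLValue_ne_zero_of_selmer`, run at the prime `p = 2`.
[cite: Kato2004Asterisque, Cor. 14.3 (1)(2) (p. 235)] -/
theorem kato_finite_chiPart_of_twistedLValue_ne_zero_of_kato_finite_chiPart_selmer
    (h : kato_finite_chiPart_selmer_of_twistedLValue_ne_zero) :
    kato_finite_chiPart_of_twistedLValue_ne_zero :=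
  kato_finite_chiPart_of_twistedLValue_ne_zero_of_selmer
    fun W _ _ _ _ hf _ _ hm χ hL => ⟨2, ⟨Nat.prime_two⟩, h W hf hm χ hL 2⟩

/-- **Kato 2004, Cor. 14.3: (1) ⇒ (2) over `ℚ(ζ_m)` for EVERY `m ≥ 1`** (mod-`m` twisted series,
any decidability instance on `ℚ(ζ_m)`): the all-moduli named fact
`kato_finite_chiPart_cyclotomic_of_twistedLValue_ne_zero` follows from the Selmer-level named fact
`kato_finite_chiPart_selmer_of_twistedLValue_ne_zero` — the previous theorem followed by the
proved reduction of `m ≡ 2 (mod 4)` to `m/2`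
(`kato_finite_chiPart_cyclotomic_of_twistedLValue_ne_zero_of`).
[cite: Kato2004Asterisque, Cor. 14.3 (1)(2) (p. 235)] -/
theorem kato_finite_chiPart_cyclotomic_of_twistedLValue_ne_zero_of_kato_finite_chiPart_selmer
    (h : kato_finite_chiPart_selmer_of_twistedLValue_ne_zero) :
    kato_finite_chiPart_cyclotomic_of_twistedLValue_ne_zero :=
  fun W _ _ _ _ hf _ _ _ χ hL =>
    kato_finite_chiPart_cyclotomic_of_twistedLValue_ne_zero_of
      (kato_finite_chiPart_of_twistedLValue_ne_zero_of_kato_finite_chiPart_selmer h) W hf χ hL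

end Literature.NumberTheory.EllipticCurves

end
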